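import Summits.BirchSwinnertonDyer.BirchSwinnertonDyer.Theorems.ClassRecordThreeEulerHalvesAtThreeCartanCoverPrintClausesTorsionFree
import Summits.BirchSwinnertonDyer.BirchSwinnertonDyer.Theorems.ClassRecordThreeEulerHalvesAtThreeCartanCoverCocompact
import Literature.Geometry.Manifold.QuotientManifold
import HarnessLib

/-!
# Crux NUM `CartanOnePlaceDegreeLawAtThree` (item 24801), line `lattice` — the print clauses VII: THE QUOTIENT `Γ∖ℍ` OF A TORSION-FREE, PROPERLY DISCONTINUOUS
# `Γ ≤ SL₂(ℝ)` IS A RIEMANN SURFACE (complex `1`-manifold, `T₂`, connected; compact when `Γ` is cocompact) AND `ℍ → Γ∖ℍ` IS A HOLOMORPHIC COVERING; the principal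
# level `Γ̄(q)∖ℍ` of a Cartan datum (`q` odd, `D > 1`) is a COMPACT RIEMANN SURFACE

Seat `bsd-stepL-tam3-p1` g29 (LEAD of crux 24801; `--supports stmt-BirchSwinnertonDyer-24801 --as helper`). Brick E2 of the LEAD's in-tree route to the SURJECTIVITY half
of (ESᶜ) `eichlerShimura_weightTwo_rePeriod` at `D > 1` (roadmap in the LEAD's HANDOFF: E1 Minkowski = `…PrintClausesTorsionFree`; E2 here; E3 `S₂(Γ̄(q)) ≅ Ω¹(Γ̄(q)∖ℍ)`;
E4 `π₁ ≅ Γ̄(q)`; E5 dimension count + injectivity (`…PrintClausesCocompact`); E6 averaging `Γ̄(q) → Γ`). The Riemann-surface library of the tree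
(`Literature.Geometry.Kaehler.RiemannSurface…`, e.g. `existsUnique_re_period_eq` — Farkas–Kra III.3.4 (b), existence) takes as input exactly a type with
`[ChartedSpace ℂ M] [IsManifold 𝓘(ℂ) ω M] [CompactSpace M] [T2Space M] [ConnectedSpace M]`; this file produces such a type from the crux's groups.

* §1 (any `Γ ≤ GL₂(ℝ)` with `det = 1`, acting properly discontinuously on `ℍ`): stabilisers are finite (`finite_stabilizer`); if `Γ` is TORSION-FREE the action is FREE
  (`isCancelSMul_of_torsionFree`, Mathlib `isCancelSMul_iff_eq_one_of_smul_eq`); for a free such action the orbit space `MulAction.orbitRel.Quotient Γ ℍ` with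
  Mathlib's charted-space structure (`MulAction.instChartedSpaceQuotient`) is a complex manifold (`isManifold_orbitQuotient`: the tree's
  `Literature.Geometry.Manifold.QuotientManifold.isManifold` + Mathlib `UpperHalfPlane.contMDiff_smul`), the projection is holomorphic, a local diffeomorphism and a
  quotient covering map (`contMDiff_orbitQuotientMk`, `isLocalDiffeomorph_orbitQuotientMk`, `isQuotientCoveringMap_orbitQuotientMk`), the quotient is `T₂` (Mathlib),
  CONNECTED (`ℍ` is contractible) and COMPACT when a compact set meets every orbit (both private here: their `Subgroup SL(2, ℝ)` twins are the tree's
  `QuaternionType.connectedSpace_orbitQuotient` ∕ `compactSpace_orbitQuotient_of_isCompact_reps`).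
* §2 (the crux's groups): for a Cartan datum `X` and an ODD prime `q`, `Γ̄(q) = CartanCover.principalLevel X q` acts properly discontinuously and — being torsion-free
  (`principalLevel_torsionFree`, E1) — freely (`isCancelSMul_principalLevel`); it has finitely many cosets in the cover group (`exists_finset_leftCosets_principalLevel`:
  coordinates mod `q` in a `ℤ`-basis of `O₀'`), hence is cocompact for `D > 1` (`principalLevel_exists_isCompact_reps_of_one_lt`); so **`Γ̄(q)∖ℍ` is a compact connected
  `T₂` Riemann surface with holomorphic covering projection** (`isManifold_principalLevelQuotient`, `compactSpace_principalLevelQuotient_of_one_lt`, …).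

Theorems only (instances are provided as theorems to be introduced with `haveI`); nothing about NUM or any curve is proved; BSD is proved for no curve.
[cite: ShimuraIATAF1971, §1.5 (the quotient Γ∖ℌ* as a Riemann surface) and §9.2 p. 246] [cite: FarkasKra1992, IV.5 (ℍ∕Γ for fixed-point-free Γ)] [cite: Bergeron2016, §2.3 Cor. 2.11 p. 44]
-/

set_option linter.dupNamespace false
set_option autoImplicit false

noncomputable section

open scoped MatrixGroups Manifold ContDiff Topology Pointwise
open Function Set

namespace Summit.BirchSwinnertonDyer.BirchSwinnertonDyer.Theorems.CartanCover.PrintClauses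

open Literature.NumberTheory.Automorphic
open Literature.Geometry.Manifold

/-! ## §1 Free properly discontinuous subgroups of `SL₂(ℝ)`: the quotient Riemann surface -/

section General

variable (Γ : Subgroup (GL (Fin 2) ℝ))

/-- **Stabilisers of a properly discontinuous action on `ℍ` are finite.** [cite: ShimuraIATAF1971, §1.5 Prop. 1.16] -/
theorem finite_stabilizer [ProperlyDiscontinuousSMul Γ UpperHalfPlane] (τ : UpperHalfPlane) :
    (MulAction.stabilizer Γ τ : Set Γ).Finite := by
  have h := ProperlyDiscontinuousSMul.finite_disjoint_inter_image (Γ := Γ) (T := UpperHalfPlane)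
    (isCompact_singleton (x := τ)) (isCompact_singleton (x := τ))
  refine h.subset ?_
  intro γ hγ
  have hγ' : γ • τ = τ := hγ
  exact ⟨τ, ⟨τ, rfl, hγ'⟩, rfl⟩

/-- **A torsion-free properly discontinuous `Γ` acts FREELY on `ℍ`** (an element with a fixed point lies in a finite stabiliser, hence has finite order).
[cite: FarkasKra1992, IV.5] [cite: Bergeron2016, §2.3 p. 44] -/
theorem isCancelSMul_of_torsionFree [ProperlyDiscontinuousSMul Γ UpperHalfPlane] (htf : ∀ γ : Γ, IsOfFinOrder γ → γ = 1) :
    IsCancelSMul Γ UpperHalfPlane := by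
  refine isCancelSMul_iff_eq_one_of_smul_eq.mpr fun γ τ hγτ => htf γ ?_
  have hmem : γ ∈ MulAction.stabilizer Γ τ := hγτ
  haveI : Finite (MulAction.stabilizer Γ τ) := (finite_stabilizer Γ τ).to_subtype
  have hfo : IsOfFinOrder (⟨γ, hmem⟩ : MulAction.stabilizer Γ τ) := isOfFinOrder_of_finite _
  exact (MulAction.stabilizer Γ τ).subtype.isOfFinOrder hfo

variable [Γ.HasDetOne]

/-- Elements of `Γ ≤ SL₂(ℝ)` act holomorphically on `ℍ` (Mathlib `UpperHalfPlane.contMDiff_smul`). [folklore] -/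
theorem contMDiff_subgroup_smul (γ : Γ) : ContMDiff 𝓘(ℂ) 𝓘(ℂ) ω (fun τ : UpperHalfPlane => γ • τ) := by
  have hdet : 0 < (γ : GL (Fin 2) ℝ).det.val := by
    rw [Subgroup.HasDetOne.det_eq γ.2, Units.val_one]; exact one_pos
  exact UpperHalfPlane.contMDiff_smul hdet

variable [ProperlyDiscontinuousSMul Γ UpperHalfPlane] [IsCancelSMul Γ UpperHalfPlane]

/-- **`Γ∖ℍ` IS A RIEMANN SURFACE**: for a free properly discontinuous `Γ ≤ SL₂(ℝ)`, Mathlib's charted space `MulAction.orbitRel.Quotient Γ ℍ` is a complex manifold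
(tree `QuotientManifold.isManifold`). [cite: FarkasKra1992, IV.5] [cite: ShimuraIATAF1971, §1.5] -/
theorem isManifold_orbitQuotient : IsManifold 𝓘(ℂ) ω (MulAction.orbitRel.Quotient Γ UpperHalfPlane) :=
  QuotientManifold.isManifold (contMDiff_subgroup_smul Γ)

/-- **The projection `ℍ → Γ∖ℍ` is holomorphic.** [cite: FarkasKra1992, IV.5] -/
theorem contMDiff_orbitQuotientMk :
    haveI := isManifold_orbitQuotient Γ
    ContMDiff 𝓘(ℂ) 𝓘(ℂ) ω (QuotientManifold.mk (G := Γ) (M := UpperHalfPlane)) :=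
  QuotientManifold.contMDiff_mk (contMDiff_subgroup_smul Γ)

/-- **The projection `ℍ → Γ∖ℍ` is a holomorphic local diffeomorphism.** [cite: FarkasKra1992, IV.5] -/
theorem isLocalDiffeomorph_orbitQuotientMk :
    haveI := isManifold_orbitQuotient Γ
    IsLocalDiffeomorph 𝓘(ℂ) 𝓘(ℂ) ω (QuotientManifold.mk (G := Γ) (M := UpperHalfPlane)) :=
  QuotientManifold.isLocalDiffeomorph_mk (contMDiff_subgroup_smul Γ)

omit [Γ.HasDetOne] in
/-- **The projection `ℍ → Γ∖ℍ` is a quotient covering map with deck group `Γ`** (Mathlib; free properly discontinuous action). [cite: HatcherAT2002, §1.3 Prop. 1.40] -/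
theorem isQuotientCoveringMap_orbitQuotientMk :
    IsQuotientCoveringMap (Quotient.mk (MulAction.orbitRel Γ UpperHalfPlane) : UpperHalfPlane → MulAction.orbitRel.Quotient Γ UpperHalfPlane) Γ :=
  isQuotientCoveringMap_quotientMk_of_properlyDiscontinuousSMul

omit [Γ.HasDetOne] [ProperlyDiscontinuousSMul Γ UpperHalfPlane] [IsCancelSMul Γ UpperHalfPlane] in
/-- **`Γ∖ℍ` is connected** (`ℍ` is contractible, the projection is a continuous surjection). Private: the `SL₂(ℝ)`-subgroup twin is the tree's
`QuaternionType.connectedSpace_orbitQuotient` (`ComplexTorusQuaternionCongruenceQuotientCovering`). [folklore] -/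
private theorem connectedSpace_orbitQuotient : ConnectedSpace (MulAction.orbitRel.Quotient Γ UpperHalfPlane) :=
  Quotient.instConnectedSpace

omit [Γ.HasDetOne] [ProperlyDiscontinuousSMul Γ UpperHalfPlane] [IsCancelSMul Γ UpperHalfPlane] in
/-- **`Γ∖ℍ` is compact when a compact set meets every orbit.** Private: the `SL₂(ℝ)`-subgroup twin is the tree's
`QuaternionType.compactSpace_orbitQuotient_of_isCompact_reps` (`ComplexTorusQuaternionUnitGroupCompactSubgroups`). [cite: ShimuraIATAF1971, §1.5 and Prop. 9.3] -/
private theorem compactSpace_orbitQuotient_of_isCompact_reps {K : Set UpperHalfPlane} (hK : IsCompact K)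
    (hcov : ∀ z : UpperHalfPlane, ∃ γ ∈ Γ, γ • z ∈ K) : CompactSpace (MulAction.orbitRel.Quotient Γ UpperHalfPlane) := by
  refine ⟨?_⟩
  have hsurj : (Quotient.mk (MulAction.orbitRel Γ UpperHalfPlane)) '' K = Set.univ := by
    refine Set.eq_univ_of_forall fun y => ?_
    induction y using Quotient.inductionOn with
    | h z =>
      obtain ⟨γ, hγ, hγz⟩ := hcov z
      refine ⟨γ • z, hγz, Quotient.sound ⟨⟨γ, hγ⟩, rfl⟩⟩
  rw [← hsurj]
  exact hK.image continuous_quot_mk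

end General

/-! ## §2 The principal level `Γ̄(q)∖ℍ` of a Cartan datum -/

section PrincipalLevel

variable {D M : ℕ} {C : Finset ℕ} (X : CartanLevelCurveData D M C) (q : ℕ)

/-- `Γ̄(q)` lies in the hull group `ι(O₀¹)`. [folklore] -/
theorem principalLevel_le_hullUnits : principalLevel X q ≤ normOneUnits X.ι X.isEichlerOrder.isOrder :=
  (principalLevel_le_coverUnits X q).trans
    (CartanTransport.Hull.normOneUnits_mono X.ι (isOrder_coverOrder X q) X.isEichlerOrder.isOrder (coverOrder_le X q))

/-- **`Γ̄(q)` acts properly discontinuously on `ℍ`** (a subgroup of the hull group). [cite: VignerasLNM800, Ch. IV §1 Thm. 1.1 (1)] -/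
theorem properlyDiscontinuousSMul_principalLevel : ProperlyDiscontinuousSMul (principalLevel X q) UpperHalfPlane := by
  obtain ⟨fd₀, h₀⟩ := CartanTransport.Hull.exists_isHypFundamentalDomain_hull X
  have hH : ProperlyDiscontinuousSMul (X.toShimuraCurveData fd₀ h₀).Gamma UpperHalfPlane :=
    (X.toShimuraCurveData fd₀ h₀).properlyDiscontinuousSMul_Gamma
  rw [Subgroup.properlyDiscontinuousSMul_iff] at hH ⊢
  intro K L hK hL
  refine (hH hK hL).subset ?_
  rintro γ ⟨hγ, hKL⟩
  exact ⟨principalLevel_le_hullUnits X q hγ, hKL⟩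

/-- **`Γ̄(q)` acts FREELY on `ℍ` for an odd prime `q`** (torsion-free: Minkowski, `principalLevel_torsionFree`). [cite: Bergeron2016, §2.3 Cor. 2.11 p. 44]
[cite: Serre1971CohomologieGroupesDiscrets, §1.8] -/
theorem isCancelSMul_principalLevel (hq : q.Prime) (hq2 : q ≠ 2) : IsCancelSMul (principalLevel X q) UpperHalfPlane := by
  haveI := properlyDiscontinuousSMul_principalLevel X q
  exact isCancelSMul_of_torsionFree (principalLevel X q) fun γ hγ => principalLevel_torsionFree' X q hq hq2 γ hγ

/-- **Finitely many cosets of `Γ̄(q)` in the cover group `ι(O₀'¹)`** (coordinates modulo `q` in a `ℤ`-basis of `O₀'`: two cover units with the same coordinates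
`u, u'` have `u⁻¹u' − 1 = u⁻¹(u' − u) ∈ q·O₀'`, i.e. `u⁻¹u' ∈ Γ̄(q)`). [cite: VignerasLNM800, Ch. IV §1] -/
theorem exists_finset_leftCosets_principalLevel (hq0 : q ≠ 0) :
    ∃ T : Finset (GL (Fin 2) ℝ), (∀ t ∈ T, t ∈ coverUnits X q) ∧ ∀ γ ∈ coverUnits X q, ∃ t ∈ T, t⁻¹ * γ ∈ principalLevel X q := by
  classical
  have hO₁ := isOrder_coverOrder X q
  haveI : NeZero q := ⟨hq0⟩
  obtain ⟨b⟩ := hO₁.isFullLattice.nonempty_basis_fin_four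
  let coord : coverOrder X q → (Fin 4 → ZMod q) := fun x i => ((b.repr x i : ℤ) : ZMod q)
  have hcoord : ∀ x y : coverOrder X q, coord x = coord y → ∃ z : coverOrder X q, (x : X.B) - y = (q : ℤ) • (z : X.B) := by
    intro x y hxy
    have hdiv : ∀ i, (q : ℤ) ∣ b.repr x i - b.repr y i := by
      intro i
      have h := congr_fun hxy i
      exact (ZMod.intCast_eq_intCast_iff_dvd_sub _ _ _).mp h.symm
    choose c hc using hdiv
    refine ⟨Finsupp.linearCombination ℤ b (Finsupp.equivFunOnFinite.symm c), ?_⟩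
    have hrepr : b.repr (x - y) = (q : ℤ) • Finsupp.equivFunOnFinite.symm c := by
      ext i
      simp [hc i]
    have hxmy : x - y = (q : ℤ) • Finsupp.linearCombination ℤ b (Finsupp.equivFunOnFinite.symm c) := by
      apply b.repr.injective
      rw [hrepr, map_zsmul, b.repr_linearCombination]
    have := congrArg (fun v : coverOrder X q => (v : X.B)) hxmy
    simpa using this
  have hlift : ∀ γ ∈ coverUnits X q, ∃ u : coverOrder X q, X.ι (u : X.B) = (γ : Matrix (Fin 2) (Fin 2) ℝ) := by
    rintro γ ⟨⟨x, hx, hxγ⟩, -, -⟩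
    exact ⟨⟨x, hx⟩, hxγ⟩
  choose! lift hliftι using hlift
  have hfin : (Set.range fun γ : coverUnits X q => coord (lift γ)).Finite := Set.toFinite _
  have hrep : ∀ v ∈ Set.range (fun γ : coverUnits X q => coord (lift γ)),
      ∃ t : GL (Fin 2) ℝ, t ∈ coverUnits X q ∧ coord (lift t) = v := by
    rintro v ⟨γ, rfl⟩
    exact ⟨γ, γ.2, rfl⟩
  choose! rep hrepmem hrepcoord using hrep
  refine ⟨hfin.toFinset.image rep, ?_, ?_⟩
  · intro t ht
    obtain ⟨v, hv, rfl⟩ := Finset.mem_image.mp ht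
    exact hrepmem v (hfin.mem_toFinset.mp hv)
  · intro γ hγ
    set v := coord (lift γ) with hvdef
    have hv : v ∈ Set.range (fun γ : coverUnits X q => coord (lift γ)) := ⟨⟨γ, hγ⟩, rfl⟩
    refine ⟨rep v, Finset.mem_image.mpr ⟨v, hfin.mem_toFinset.mpr hv, rfl⟩, ?_⟩
    have ht := hrepmem v hv
    have hc : coord (lift (rep v)) = coord (lift γ) := by rw [hrepcoord v hv]
    obtain ⟨z, hz⟩ := hcoord _ _ hc
    have hmem : (rep v)⁻¹ * γ ∈ coverUnits X q := (coverUnits X q).mul_mem ((coverUnits X q).inv_mem ht) hγ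
    obtain ⟨⟨xt, hxt, hxtι⟩, ⟨yt, hyt, hytι⟩, hdet_t⟩ := ht
    obtain ⟨⟨xγ, hxγ, hxγι⟩, ⟨yγ, hyγ, hyγι⟩, hdet_γ⟩ := hγ
    have hut : (lift (rep v) : X.B) = xt := X.ι_injective (by rw [hliftι _ ⟨⟨xt, hxt, hxtι⟩, ⟨yt, hyt, hytι⟩, hdet_t⟩, hxtι])
    have huγ : (lift γ : X.B) = xγ := X.ι_injective (by rw [hliftι _ ⟨⟨xγ, hxγ, hxγι⟩, ⟨yγ, hyγ, hyγι⟩, hdet_γ⟩, hxγι])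
    have hyx : yt * xt = 1 := X.ι_injective (by rw [map_mul, hytι, hxtι, ← Units.val_mul, inv_mul_cancel, Units.val_one, map_one])
    -- `t⁻¹ γ = ι(yt * xγ)` and `yt * xγ - 1 = -(q • (yt * z))`
    refine ⟨hmem, yt * xγ, hO₁.mul_mem yt hyt xγ hxγ, by rw [map_mul, hytι, hxγι, Units.val_mul], -(yt * (z : X.B)),
      (coverOrder X q).neg_mem (hO₁.mul_mem yt hyt _ z.2), ?_⟩
    have e : (xt : X.B) - xγ = (q : ℤ) • (z : X.B) := by rw [← hut, ← huγ]; exact hz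
    calc yt * xγ - 1 = yt * xγ - yt * xt := by rw [hyx]
      _ = -(yt * (xt - xγ)) := by noncomm_ring
      _ = (q : ℤ) • -(yt * (z : X.B)) := by rw [e, mul_smul_comm, smul_neg]

/-- Transport of cocompactness to a subgroup reached by finitely many cosets (private copy of `…PrintClausesDivisionCocompact` §1, whose olean this file does not import). [folklore] -/
private theorem exists_isCompact_reps_of_finset_cosets' {Γ₁ Γ₂ : Subgroup (GL (Fin 2) ℝ)} {K : Set UpperHalfPlane} (hK : IsCompact K)
    (hcov : ∀ z : UpperHalfPlane, ∃ γ ∈ Γ₂, γ • z ∈ K) (T : Finset (GL (Fin 2) ℝ))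
    (hT : ∀ γ ∈ Γ₂, ∃ t ∈ T, t⁻¹ * γ ∈ Γ₁) :
    ∃ K₁ : Set UpperHalfPlane, IsCompact K₁ ∧ ∀ z : UpperHalfPlane, ∃ γ ∈ Γ₁, γ • z ∈ K₁ := by
  classical
  refine ⟨⋃ t ∈ T, (fun z : UpperHalfPlane => t⁻¹ • z) '' K, T.finite_toSet.isCompact_biUnion fun t _ => hK.image (continuous_const_smul _), fun z => ?_⟩
  obtain ⟨γ, hγ, hγz⟩ := hcov z
  obtain ⟨t, ht, htγ⟩ := hT γ hγ
  refine ⟨t⁻¹ * γ, htγ, Set.mem_biUnion ht ⟨γ • z, hγz, ?_⟩⟩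
  rw [mul_smul]

/-- **`Γ̄(q)` is cocompact for `D > 1`**: a compact subset of `ℍ` meets every `Γ̄(q)`-orbit (the ball of `X.Gamma ≤ ι(O₀'¹)`, tree `cartanGamma_exists_dist_le_of_one_lt`,
spread over the finitely many cosets of `Γ̄(q)` in the cover group). [cite: VignerasLNM800, Ch. IV §1 Thm. 1.1] [cite: ShimuraIATAF1971, §9.2 Prop. 9.3] -/
theorem principalLevel_exists_isCompact_reps_of_one_lt (hD : 1 < D) (hq0 : q ≠ 0) :
    ∃ K : Set UpperHalfPlane, IsCompact K ∧ ∀ z : UpperHalfPlane, ∃ γ ∈ principalLevel X q, γ • z ∈ K := by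
  obtain ⟨ρ, hρ⟩ := MapDegree.cartanGamma_exists_dist_le_of_one_lt X hD
  have hcov : ∀ z : UpperHalfPlane, ∃ γ ∈ coverUnits X q, γ • z ∈ Metric.closedBall UpperHalfPlane.I ρ := fun z => by
    obtain ⟨γ, hγ, h⟩ := hρ z
    exact ⟨γ, Gamma_le_coverUnits X q hγ, Metric.mem_closedBall.mpr h⟩
  obtain ⟨T, -, hT⟩ := exists_finset_leftCosets_principalLevel X q hq0
  exact exists_isCompact_reps_of_finset_cosets' (isCompact_closedBall _ _) hcov T hT

/-- **`Γ̄(q)∖ℍ` IS A RIEMANN SURFACE for an odd prime `q`** (complex manifold structure on Mathlib's orbit space, under the free-action instance `isCancelSMul_principalLevel`).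
[cite: FarkasKra1992, IV.5] [cite: ShimuraIATAF1971, §1.5] -/
theorem isManifold_principalLevelQuotient (hq : q.Prime) (hq2 : q ≠ 2) :
    haveI := properlyDiscontinuousSMul_principalLevel X q
    haveI := isCancelSMul_principalLevel X q hq hq2
    IsManifold 𝓘(ℂ) ω (MulAction.orbitRel.Quotient (principalLevel X q) UpperHalfPlane) := by
  haveI := properlyDiscontinuousSMul_principalLevel X q
  haveI := isCancelSMul_principalLevel X q hq hq2
  exact isManifold_orbitQuotient (principalLevel X q)

/-- **`Γ̄(q)∖ℍ` is compact for `D > 1`.** [cite: ShimuraIATAF1971, §9.2 Prop. 9.3 p. 244 and p. 246] -/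
theorem compactSpace_principalLevelQuotient_of_one_lt (hD : 1 < D) (hq0 : q ≠ 0) :
    CompactSpace (MulAction.orbitRel.Quotient (principalLevel X q) UpperHalfPlane) := by
  obtain ⟨K, hK, hcov⟩ := principalLevel_exists_isCompact_reps_of_one_lt X q hD hq0
  exact compactSpace_orbitQuotient_of_isCompact_reps (principalLevel X q) hK hcov

/-- **`Γ̄(q)∖ℍ` is `T₂`** (Mathlib, properly discontinuous action on the locally compact `T₂` space `ℍ`). [folklore] -/
theorem t2Space_principalLevelQuotient : T2Space (MulAction.orbitRel.Quotient (principalLevel X q) UpperHalfPlane) := by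
  haveI := properlyDiscontinuousSMul_principalLevel X q
  exact t2Space_of_properlyDiscontinuousSMul_of_t2Space

/-- **`Γ̄(q)∖ℍ` is connected.** [folklore] -/
theorem connectedSpace_principalLevelQuotient : ConnectedSpace (MulAction.orbitRel.Quotient (principalLevel X q) UpperHalfPlane) :=
  connectedSpace_orbitQuotient (principalLevel X q)

/-- **The projection `ℍ → Γ̄(q)∖ℍ` is a holomorphic local diffeomorphism and a quotient covering map with deck group `Γ̄(q)`** (`q` odd prime).
[cite: FarkasKra1992, IV.5] [cite: HatcherAT2002, §1.3 Prop. 1.40] -/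
theorem isLocalDiffeomorph_principalLevelQuotientMk (hq : q.Prime) (hq2 : q ≠ 2) :
    haveI := properlyDiscontinuousSMul_principalLevel X q
    haveI := isCancelSMul_principalLevel X q hq hq2
    haveI := isManifold_orbitQuotient (principalLevel X q)
    IsLocalDiffeomorph 𝓘(ℂ) 𝓘(ℂ) ω (QuotientManifold.mk (G := principalLevel X q) (M := UpperHalfPlane)) ∧
      IsQuotientCoveringMap (QuotientManifold.mk (G := principalLevel X q) (M := UpperHalfPlane)) (principalLevel X q) := by
  haveI := properlyDiscontinuousSMul_principalLevel X q
  haveI := isCancelSMul_principalLevel X q hq hq2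
  exact ⟨isLocalDiffeomorph_orbitQuotientMk (principalLevel X q), isQuotientCoveringMap_orbitQuotientMk (principalLevel X q)⟩

end PrincipalLevel

end Summit.BirchSwinnertonDyer.BirchSwinnertonDyer.Theorems.CartanCover.PrintClauses

end
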